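import Mathlib
import HarnessLib
import Summits.ValiantsHypothesis.ValiantsHypothesis.Theorems.KPlusLogSqLawWeakLiftingTowerGraftWronskianKFourLevels
import Summits.ValiantsHypothesis.ValiantsHypothesis.Theorems.LacunarySymmetroidMatrixDescartesCensusTwistedRolleMult

/-!
# Tower graft line — CONJECTURE W AT `K = 4`: WHAT A FIFTH POSITIVE ZERO FORCES (multiplicity budget and the three quotients)

Helper file for LINE (B) `Cruxes/WeakLifting/Lines/tower_graft.lean` (crux `WeakLifting` = stmt-ValiantsHypothesis-19561), continuing
`…WronskianKFourAlternating` (hand g10: five positive zeros of `W(u,v)`, `K = 4`, orientation `d₀ + d₃ < d₁ + d₂`, force the fully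
alternating Plücker cell) and `…WronskianKFourLevels` (hand g11: on that cell the positive levels of `U₂/U₁` are simple).  NO stub is
claimed.  With `Uₖ = v_k·u − u_k·v = Σₗ p_{lk} X^{dₗ}` the member of the plane omitting `X^{d_k}`:

* `countP_posRoots_wronskian_four_le_five` — the MULTIPLICITY BUDGET: on the orientation `d₀ + d₃ < d₁ + d₂` the positive zeros of
  `W(u,v)` counted WITH multiplicity are `≤ 5` (Descartes on the six-nomial `X·W`, any weak sign pattern has `≤ 5` changes);
* bookkeeping `#Z₊^{mult}(P) = Σ_{x ∈ Z₊(P)} mult_x(P)` is the tree's `Census.countP_posRoots_eq_sum_rootMultiplicity`;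
* ★ `rootMultiplicity_eq_one_of_five_le` — hence FIVE distinct positive zeros are all SIMPLE (`W′(x) ≠ 0`,
  `derivative_wronskian_eval_ne_zero_of_five_le`);
* `rootMultiplicity_wronskian_two_le_of_common_zero` — a common zero of two members is a zero of their Wronskian of multiplicity `≥ 2`
  (`W′ = f g″ − f″ g`), so at five positive zeros the common-zero alternative of `…KFourLevels.wronskian_root_special_product_neg` is
  excluded (sequel);
* the strict sign conditions at five zeros and the two other quotients `U₃/U₂`, `U₃/U₁` are in the sequel `…WronskianKFourQuotients`.

So a counterexample to Conjecture W at `K = 4` consists of five SIMPLE positive zeros, each a turning point of all three quotients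
`U₂/U₁`, `U₃/U₂`, `U₃/U₁`, at levels of fixed sign (`< 0`, `< 0`, `> 0`): the input of the lap-counting calculus recorded in the memo
`evidence-g11-conjectureW-K4-levels.md` on the item (which pins the lap type of a counterexample but does NOT exclude it — Conjecture W at
`K = 4` for arcs stays OPEN).  HONEST FRAMING: nothing on S4/S4f/S5/S5ᴸ, TowerB, `WeakLifting`, Conjecture B, `MatrixDescartes` (18050),
`VP ≠ VNP`.  Def-free.  Seat: prover leafhand-val-kpluslogsqlaw-1 g11, `--supports stmt-ValiantsHypothesis-19561 --as helper`.
[folklore: Descartes' rule of signs with multiplicity (Mathlib `roots_countP_pos_le_signVariations`); the packaging is this work]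
-/

-- `Summit.ValiantsHypothesis.ValiantsHypothesis.…` repeats a component by the D-0017 layout
-- (single-conjunct summit), which the `dupNamespace` linter flags; the name is mandated.
set_option linter.dupNamespace false
set_option autoImplicit false

namespace Summit.ValiantsHypothesis.ValiantsHypothesis.Theorems.KPlusLogSqLaw.TowerGraft

open Polynomial Finset
open scoped BigOperators Polynomial
open Summit.ValiantsHypothesis.ValiantsHypothesis.Theorems.LacunarySymmetroidMatrixDescartes.Census
  (signVariations_rsum_le_changes mul_pos_of_mul_neg_of_mul_neg mul_neg_of_mul_pos_of_mul_neg countP_posRoots_eq_sum_rootMultiplicity)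

namespace WronskianDevelopable

/-! ## §1 The multiplicity budget `5` and simplicity of five zeros -/

/-- **multiplicity budget**: on the orientation `d₀ + d₃ < d₁ + d₂` the Wronskian of two `4`-nomials has at most `5` positive zeros
COUNTED WITH MULTIPLICITY (`X·W` is a six-nomial on the sorted pair sums; Descartes against the weak pattern `0 ≤ ·`). [folklore] -/
theorem countP_posRoots_wronskian_four_le_five (u v : Fin 4 → ℝ) (d : Fin 4 → ℕ) (hd : StrictMono d) (hA : d 0 + d 3 < d 1 + d 2) :
    (wronskian (∑ l, C (u l) * (X : ℝ[X]) ^ d l) (∑ l, C (v l) * (X : ℝ[X]) ^ d l)).roots.countP (fun x => 0 < x) ≤ 5 := by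
  classical
  set W : ℝ[X] := wronskian (∑ l, C (u l) * (X : ℝ[X]) ^ d l) (∑ l, C (v l) * (X : ℝ[X]) ^ d l) with hWdef
  by_cases hW : W = 0
  · simp [hW]
  -- `Z₊^{mult}(W) = Z₊^{mult}(X·W)`
  have hXW : (X * W).roots.countP (fun x => 0 < x) = W.roots.countP (fun x => 0 < x) := by
    rw [roots_mul (mul_ne_zero X_ne_zero hW), roots_X, Multiset.countP_add]
    have h0 : Multiset.countP (fun x : ℝ => 0 < x) ({0} : Multiset ℝ) = 0 := Multiset.countP_eq_zero.mpr (by simp)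
    rw [h0, zero_add]
  rw [← hXW]
  set c : ℕ → ℝ := fun t : ℕ => if t = 0 then (u 0 * v 1 - u 1 * v 0) * ((d 1 : ℝ) - d 0)
        else if t = 1 then (u 0 * v 2 - u 2 * v 0) * ((d 2 : ℝ) - d 0)
        else if t = 2 then (u 0 * v 3 - u 3 * v 0) * ((d 3 : ℝ) - d 0) else if t = 3 then (u 1 * v 2 - u 2 * v 1) * ((d 2 : ℝ) - d 1)
        else if t = 4 then (u 1 * v 3 - u 3 * v 1) * ((d 3 : ℝ) - d 1) else if t = 5 then (u 2 * v 3 - u 3 * v 2) * ((d 3 : ℝ) - d 2)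
        else 0 with hc
  obtain ⟨e, he, he0, he1, he2, he3, he4, he5⟩ := exists_strictMono_pairSums d hd hA
  have hrsum := X_mul_wronskian_four_eq_rsum u v d e he0 he1 he2 he3 he4 he5
  rw [hWdef, hrsum]
  refine (Polynomial.roots_countP_pos_le_signVariations _).trans ?_
  have h3 := signVariations_rsum_le_changes 6 e he c (fun t => decide (0 ≤ c t))
    (fun t _ ht => of_decide_eq_true ht) (fun t _ ht => by
      have : ¬ (0 ≤ c t) := of_decide_eq_false ht
      exact le_of_lt (not_le.mp this))
  refine h3.trans ?_
  exact (Finset.sum_le_card_nsmul _ _ 1 (fun t _ => by split_ifs <;> simp)).trans (by simp)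

/-- ★ **five distinct positive zeros are all simple.** [this work] -/
theorem rootMultiplicity_eq_one_of_five_le (u v : Fin 4 → ℝ) (d : Fin 4 → ℕ) (hd : StrictMono d) (hA : d 0 + d 3 < d 1 + d 2)
    (h5 : 5 ≤ ((wronskian (∑ l, C (u l) * (X : ℝ[X]) ^ d l) (∑ l, C (v l) * (X : ℝ[X]) ^ d l)).roots.toFinset.filter
      (fun x => 0 < x)).card)
    {x : ℝ} (hx : x ∈ (wronskian (∑ l, C (u l) * (X : ℝ[X]) ^ d l) (∑ l, C (v l) * (X : ℝ[X]) ^ d l)).roots.toFinset.filter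
      (fun x => 0 < x)) :
    (wronskian (∑ l, C (u l) * (X : ℝ[X]) ^ d l) (∑ l, C (v l) * (X : ℝ[X]) ^ d l)).rootMultiplicity x = 1 := by
  classical
  set W : ℝ[X] := wronskian (∑ l, C (u l) * (X : ℝ[X]) ^ d l) (∑ l, C (v l) * (X : ℝ[X]) ^ d l) with hWdef
  set S := W.roots.toFinset.filter (fun x => 0 < x) with hS
  have hW : W ≠ 0 := by
    intro h0
    have : S.card = 0 := by simp [hS, h0]
    omega
  have hsum : ∑ y ∈ S, W.rootMultiplicity y ≤ 5 := by
    rw [← countP_posRoots_eq_sum_rootMultiplicity]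
    exact countP_posRoots_wronskian_four_le_five u v d hd hA
  have hge : ∀ y ∈ S, 1 ≤ W.rootMultiplicity y := by
    intro y hy
    rw [hS, Finset.mem_filter, Multiset.mem_toFinset] at hy
    exact (rootMultiplicity_pos hW).mpr ((mem_roots hW).mp hy.1)
  have hx1 : 1 ≤ W.rootMultiplicity x := hge x hx
  by_contra hne
  have hx2 : 2 ≤ W.rootMultiplicity x := by omega
  have hsplit := Finset.add_sum_erase S (fun y => W.rootMultiplicity y) hx
  have hrest : (S.erase x).card • 1 ≤ ∑ y ∈ S.erase x, W.rootMultiplicity y :=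
    Finset.card_nsmul_le_sum _ _ 1 (fun y hy => hge y (Finset.mem_of_mem_erase hy))
  rw [Finset.card_erase_of_mem hx, smul_eq_mul, mul_one] at hrest
  have hcard : 1 ≤ S.card := Finset.card_pos.mpr ⟨x, hx⟩
  omega

/-- so at each of five positive zeros the derivative of the Wronskian does not vanish. [this work] -/
theorem derivative_wronskian_eval_ne_zero_of_five_le (u v : Fin 4 → ℝ) (d : Fin 4 → ℕ) (hd : StrictMono d)
    (hA : d 0 + d 3 < d 1 + d 2)
    (h5 : 5 ≤ ((wronskian (∑ l, C (u l) * (X : ℝ[X]) ^ d l) (∑ l, C (v l) * (X : ℝ[X]) ^ d l)).roots.toFinset.filter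
      (fun x => 0 < x)).card)
    {x : ℝ} (hx : x ∈ (wronskian (∑ l, C (u l) * (X : ℝ[X]) ^ d l) (∑ l, C (v l) * (X : ℝ[X]) ^ d l)).roots.toFinset.filter
      (fun x => 0 < x)) :
    (derivative (wronskian (∑ l, C (u l) * (X : ℝ[X]) ^ d l) (∑ l, C (v l) * (X : ℝ[X]) ^ d l))).eval x ≠ 0 := by
  classical
  set W : ℝ[X] := wronskian (∑ l, C (u l) * (X : ℝ[X]) ^ d l) (∑ l, C (v l) * (X : ℝ[X]) ^ d l) with hWdef
  have hmult := rootMultiplicity_eq_one_of_five_le u v d hd hA h5 hx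
  have hW : W ≠ 0 := by
    intro h0
    have : (W.roots.toFinset.filter (fun x => 0 < x)).card = 0 := by simp [h0]
    omega
  intro hder
  have hroot : W.IsRoot x := by
    rw [Finset.mem_filter, Multiset.mem_toFinset] at hx
    exact (mem_roots hW).mp hx.1
  have h2 : 1 < W.rootMultiplicity x := (one_lt_rootMultiplicity_iff_isRoot hW).mpr ⟨hroot, hder⟩
  rw [← hWdef] at hmult
  omega

/-! ## §2 A common zero is a double zero of the Wronskian -/

/-- `W(f,g)′ = f·g″ − f″·g`. [folklore] -/
theorem derivative_wronskian_eq (f g : ℝ[X]) :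
    derivative (wronskian f g) = f * derivative (derivative g) - derivative (derivative f) * g := by
  simp only [wronskian, derivative_sub, derivative_mul]
  ring

/-- **a common zero of `f` and `g` is a zero of `W(f,g)` of multiplicity at least two** (when `W(f,g) ≠ 0`). [folklore] -/
theorem rootMultiplicity_wronskian_two_le_of_common_zero (f g : ℝ[X]) {x : ℝ} (hf : f.eval x = 0) (hg : g.eval x = 0)
    (hW : wronskian f g ≠ 0) : 2 ≤ (wronskian f g).rootMultiplicity x := by
  have h0 : (wronskian f g).IsRoot x := by
    simp [IsRoot, InflectionLaw.eval_wronskian, hf, hg]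
  have h1 : (derivative (wronskian f g)).IsRoot x := by
    simp [IsRoot, derivative_wronskian_eq, hf, hg]
  have := (one_lt_rootMultiplicity_iff_isRoot hW).mpr ⟨h0, h1⟩
  omega

end WronskianDevelopable

end Summit.ValiantsHypothesis.ValiantsHypothesis.Theorems.KPlusLogSqLaw.TowerGraft
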